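import Summits.AnomalousDissipation.AnomalousDissipation.Theses.TaylorCertificates
import Summits.AnomalousDissipation.AnomalousDissipation.Theorems.TaylorCertificatesSteadyStatesLoudBoundedStubResidualTransfer
import Summits.AnomalousDissipation.AnomalousDissipation.Theorems.TaylorCertificatesSteadyStatesLoudBoundedStubCompactnessSplit
import Summits.AnomalousDissipation.AnomalousDissipation.Theorems.TaylorCertificatesSteadyStatesLoudBoundedStubTruncationResidual
import Summits.AnomalousDissipation.AnomalousDissipation.Theorems.TaylorCertificatesSteadyStatesLoudBoundedStubDodgerAssembly
import Summits.AnomalousDissipation.AnomalousDissipation.Theorems.EnsembleCeiling.Negative.BeltramiFat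
import Summits.AnomalousDissipation.AnomalousDissipation.Theorems.EnsembleCeiling.Negative.DiracAtoms
import Literature.Analysis.FluidPDE.StatisticalSolution
import HarnessLib.Audit

/-!
# Line `lamb-floor-f123-shared-ceiling` for crux `TaylorCertificates.SteadyStatesLoudBounded`
# (stmt-AnomalousDissipation-13038) — CHECKED SKELETON (crux-strategist, 2026-08-16; owned by lead c1 since 2026-08-16T19:15Z,
# RESHAPED by lead c1 2026-08-16T23:30Z (variant B, registered): S1′ `stub_f123NoOnsagerDodgerLevel3` (floor bet at the ONE
# energy level the composition consumes), S2′ `stub_f123EnsembleCeiling2` (the shared ensemble ceiling with the EXPLICIT constant 2);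
# variant A stubs `stub_f123NoOnsagerDodger` (∀E) / `stub_f123EnsembleCeiling` (∃E) archived — reasons in the two stub docstrings and in
# Lines/lamb-floor-f123-shared-ceiling-S1-c1.md §5 (the ∀E floor is threatened generically by large-drift vortex-sheet dodgers, lead a1's
# Theorem A + §3b conjecture; the composition needs only the levels E, E+1 with E the ceiling; numerics j019660: E ≤ 1.13 on the resolved
# primary branch down to ν = 0.002, loud throughout))

Crux (route file, BY NAME): `∃ f` smooth div-free mean-zero, `∃ ε₀ E ν₀`, `0 < ε₀`, `0 < ν₀`, such that for
`ν ∈ (0, ν₀)` EVERY smooth div-free mean-zero classical steady state `u` of `NS_ν(f)` has the FLOOR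
`ε₀ ≤ ν‖∇u‖²` and the CEILING `∫|u|² ≤ E`.

## Why this line exists (strategist re-line after the death of `lojasiewicz-lamb-floor-ladder`)

The only registered line died at its CEILING stub pinned on the Galloway–Proctor force `f_GP`
(`Lines/lojasiewicz-lamb-floor-ladder-dead.md`: fat laminar half-branch `u = h₊/ν + νw̃` on the ABC
Beltrami ray, kit j015722/j014809; also EnsembleCeiling TRIAGE-r1-1 §N1). Its FLOOR machinery is
force-agnostic and LANDED (S2 `stub_residualTransfer` p85255, S3 `stub_compactnessSplit` p85561,
S4a `stub_truncationResidual` p85500, S4b `stub_dodgerAssembly` p89006). This skeleton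

1. RE-PINS the witness on the detuned cyclic force `f₁₂₃ = (sin 2πx₃, sin 4πx₁, sin 6πx₂)` — the route's one LIVE
   candidate force: picked by the sibling crux `EnsembleCeiling` (stmt-14090; skeleton
   `Cruxes/EnsembleCeiling/Lines/sweep_test_cyclic_tlf_witness.lean`, item since mooted by the rev-13 drop but its
   skeleton, Negative lemmas and triage numerics stand in the tree) and named as the live candidate of the target `X`
   (`Cruxes/FloorCertificateEnsembleCeiling/Lines/Sketch.lean` §E, `Sketch-dead.md`) — which passes every screen that
   killed `f_GP`: three linearly polarised Stokes modes on THREE shells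
   (`|k|² = 1, 4, 9`), so no shell carries a multi-mode Beltrami (ABC) sub-sum and every helical component is a
   single circularly polarised wave whose linearised steady-Euler operator has an infinite-dimensional
   cokernel (all fields depending on the wave's own phase) that the other two modes violate at first order
   (no regular fat half-branch `tB/ν + O(ν)`: the `f_GP` mechanism is dead on arrival here); frustrated on
   every mode line in the sense of `Cruxes/FloorCertificate/Ideas/shear-sheltering-dichotomy.md` test (c)
   (rational polarisation along a lattice vector + a roll-forced `Π₀`-mode on each line); genuinely
   three-dimensional (`supp f̂` spans `ℝ³`: no translation-invariant direction, so Disproof §6/§7 and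
   `Negative/Planar.not_steadyStatesLoudBounded_planar` do not instantiate); Stokes state not Euler-steady
   (`(f·∇)f` has a curl: Disproof §9 `not_body_neg_laplacian_of_euler` does not fire). Numerics on record
   (EnsembleCeiling TRIAGE-r1-1 §N2, K = 4/5 Galerkin Newton + 32³ DNS, kit j009652/j013457/j013464/j009658):
   the Stokes-connected steady branch SATURATES at `‖u‖₂ = 0.99 → 0.75` for `ν = 0.01 → 0.005` (unit torus),
   the fat gravest-shear datum collapses onto it, and the gravest-shear-ray Newton seed falls on the same
   branch (no separate fat ray branch) — the `Re ≍ Gr^{1/2}` saturation the crux asks for. The strategist's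
   own screen (kit j018395: primary branch `E, D` versus `ν` at K = 6/8 — the DISSIPATION along the branch,
   which nobody had recorded — plus helical-ray / 2-mode-trap / random seeds and a quiet-point least-squares
   search) is reported in `Lines/lamb-floor-f123-shared-ceiling.md` and `STRATEGY-CENSUS.md`.
2. SHARES THE CEILING with the route's target instead of carrying a bare steady-ceiling stub: the held stub
   `stub_f123EnsembleCeiling` is the ENSEMBLE-CEILING HALF of `X = FloorCertificateEnsembleCeiling` (rank 0, open)
   and of the pair #7 instantiated AT `f₁₂₃`, and it is VERBATIM the conclusion type of the in-tree sibling
   composition `SweepTestCyclicTlfWitness.ceilingAt_f123_of_stubs`, so the three sibling stubs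
   (`stub_fedHotExclusion`, `stub_fedWarmExclusion`, `stub_starvedRide`) close it with one `exact`; the steady
   ceiling the composition needs is DERIVED here sorry-free (Dirac masses at steady states are stationary
   statistical solutions: `DiracAtoms.norm_sq_le_of_ceiling` + the in-file bridge `exists_steadyState_of_classical'`).
   One ceiling proof at `f₁₂₃` then serves this crux AND `X` — the same-force coupling the route's thesis demands.
3. Keeps ONE floor bet, `stub_f123NoOnsagerDodger` (the Łojasiewicz/Lamb-rigidity floor made ν-free, at `f₁₂₃`).

So the skeleton has exactly TWO registered stubs, both genuine and both open-problem grade, and everything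
else is landed mathematics or kernel-checked glue. Admissibility of `f₁₂₃` is PROVED in this file.

## Composition `SteadyStatesLoudBounded_of` (kernel-checked, no sorry outside the two stubs)
`E = 2`, `ν₁` from the derived steady ceiling; enemy (Q) (finite-enstrophy standing flows of `f₁₂₃` in the `E`-ball)
excluded by S4a+S4b+`stub_f123NoOnsagerDodger` one level up; `(c, δ₀)` from the compactness split S3;
`ν₀ := min ν₁ 1`, `ε₀ := min c δ₀²`; floor from the residual transfer S2 (`ν < 1 ⇒ δ₀²/ν ≥ δ₀²`).

## Disproof used (`Cruxes/SteadyStatesLoudBounded/Disproof.lean`, cdisprove v7, read in full at the header level)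
* `cruxWithoutNuPos_false`: `0 < ν` is used in S2 (division by `ν`) and in the Dirac bridge (`norm_sq_le_of_ceiling` needs `0 < ν`).
* `cruxWithoutNuLt_false`: `ν < ν₀ ≤ 1` is used in the composition; the residual cap `δ₀` of `RigidAt` removes the
  small laminar-like states `s·A⁻¹f, s → 0` that make an uncapped rigidity false (triage r1-2/r1-3 vacuity objection).
* `not_body_fin_two`, `not_body_twoHalf_planar`, `not_body_unidirectional`, `not_body_cosX`: `f₁₂₃` depends on all three
  coordinates with all three components (`screen_threeAxes` below: the three frequencies are `e₃, 2e₁, 3e₂`).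
* `not_body_neg_laplacian_of_euler`: `f₁₂₃` is not `−ΔU` of a steady Euler flow — it is not even a Stokes
  eigenfunction (`screen_threeShells`: shell radii 1, 4, 9), and `(f·∇)f` has a curl (sibling TRIAGE-r1-2).
* `not_forall_admissible_body`: nothing is claimed for all `f`. `energy_floor_of_floor`, `energy_lower_all_steady`,
  `body_smul_iff`: consistent (amplitude fixed; every steady state of `f₁₂₃` has `‖u‖² ≥ 3/2/(2·6π + ν)`, so the
  quiet enemy, if any, lives at `O(1)` energy — exactly the regime `stub_f123NoOnsagerDodger` prices).
* `body_iff_bodyWeak`, `isSteady_iff_exists_pressure`: the stubs are stated in the crux's own smooth weak form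
  (S2, ceiling) and in the `V`-weak form (S3, S4), meeting only through limits; no regularity transfer is assumed.
* No `-- Targets` stub of the Disproof is an instance of a stub here; no landed `Negative/` lemma of THIS crux
  exists; the sibling's landed `EnsembleCeiling/Negative/*` screens are re-run below (`screen_*`).
-/

noncomputable section

set_option linter.dupNamespace false

namespace Summit.AnomalousDissipation.AnomalousDissipation.Cruxes.SteadyStatesLoudBounded.LambFloorF123SharedCeiling

open MeasureTheory Filter Topology UnitAddTorus Matrix
open scoped InnerProductSpace ENNReal ComplexConjugate
open Literature.Analysis.FunctionSpaces Literature.Analysis.FluidPDE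
open Summit.AnomalousDissipation.AnomalousDissipation.Theses.TaylorCertificates
open Summit.AnomalousDissipation.AnomalousDissipation.Theorems.TaylorCertificatePair.Negative
open Summit.AnomalousDissipation.AnomalousDissipation.Theorems.EnsembleCeiling.Negative

/-- Local notation: real vector fields on `T³`. -/
local notation "Vec3" => ((UnitAddTorus (Fin 3)) → (EuclideanSpace ℝ (Fin 3)))
/-- Local notation: `L²(T³; ℝ³)`. -/
local notation "L2" => (Lp (EuclideanSpace ℝ (Fin 3)) 2 (volume : Measure (UnitAddTorus (Fin 3))))
/-- Local notation: the energy space `H`. -/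
local notation "H3" => (Torus.energySpace (Fin 3))

/-- Local notation: the frequencies `e₃, 2e₁, 3e₂` of the detuned cyclic force (verbatim the sibling skeleton's). -/
local notation "K₁₂₃" => (![![0, 0, 1], ![2, 0, 0], ![0, 3, 0]] : Fin 3 → (Fin 3 → ℤ))
/-- Local notation: the amplitudes `-i e₁, -i e₂, -i e₃` (so that `Re(e_k z) = sin(2πk·x) eⱼ`; verbatim the sibling's). -/
local notation "Z₁₂₃" => (![(WithLp.toLp 2 ![-Complex.I, 0, 0] : EuclideanSpace ℂ (Fin 3)), (WithLp.toLp 2 ![0, -Complex.I, 0] : EuclideanSpace ℂ (Fin 3)), (WithLp.toLp 2 ![0, 0, -Complex.I] : EuclideanSpace ℂ (Fin 3))] : Fin 3 → EuclideanSpace ℂ (Fin 3))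
/-- Local notation: THE WITNESS `f₁₂₃ = (sin 2πx₃, sin 4πx₁, sin 6πx₂)` as the tree's mode sum — character for
character the sibling skeleton's `f₁₂₃`, so that `stub_f123EnsembleCeiling` below IS its composed conclusion. -/
local notation "f₁₂₃" => (∑ mm, Torus.realTrigPoly {K₁₂₃ mm} (fun _ => Z₁₂₃ mm))

/-! ## The witness is admissible (PROVED) and passes the screens -/

/-- The three frequencies are nonzero. -/
theorem f123_freq_ne_zero : ∀ m, K₁₂₃ m ≠ 0 := by decide

/-- The frequencies are in normal form (pairwise distinct and non-opposite). -/
theorem f123_normalForm : ∀ m m' : Fin 3, m ≠ m' → K₁₂₃ m ≠ K₁₂₃ m' ∧ K₁₂₃ m ≠ -K₁₂₃ m' := by decide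

/-- The amplitudes are transversal (`kₘ · zₘ = 0`): `f₁₂₃` is divergence free. -/
theorem f123_transversal : ∀ m, ((fun j => ((K₁₂₃ m) j : ℂ)) ⬝ᵥ (WithLp.ofLp (Z₁₂₃ m))) = 0 := by
  intro m
  fin_cases m <;>
    simp [dotProduct, Fin.sum_univ_three, Matrix.cons_val_zero, Matrix.cons_val_one, Matrix.cons_val_two,
      Matrix.head_cons, Matrix.tail_cons]

/-- `f₁₂₃` is smooth, divergence free and mean zero. -/
theorem f123_smooth_divFree_zeroMean :
    Torus.IsSmooth f₁₂₃ ∧ Torus.IsDivFree f₁₂₃ ∧ Torus.HasZeroMean f₁₂₃ :=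
  ⟨isSmooth_modes _ _, isDivFree_modes _ _ f123_transversal, hasZeroMean_modes _ _ f123_freq_ne_zero⟩

/-- Energy of the witness: `∫ ‖f₁₂₃‖² = 3/2` (so `f₁₂₃ ≠ 0`, cf. Disproof `force_ne_zero_of_body`). -/
theorem f123_integral_norm_sq : ∫ x, ‖f₁₂₃ x‖ ^ 2 = 3 / 2 := by
  rw [integral_norm_sq_modes_of_normalForm f123_freq_ne_zero f123_normalForm]
  simp only [Fin.sum_univ_three, Matrix.cons_val_zero, Matrix.cons_val_one, Matrix.cons_val_two,
    Matrix.head_cons, Matrix.tail_cons, EuclideanSpace.norm_eq]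
  simp [Complex.norm_I]
  norm_num

/-- SCREEN vs Disproof §6/§7 (planar / unidirectional forces): the three frequencies point along the three
DIFFERENT coordinate axes, so `f₁₂₃` is invariant under no coordinate translation (genuinely three-dimensional). -/
theorem screen_threeAxes : (K₁₂₃ 0) 2 ≠ 0 ∧ (K₁₂₃ 1) 0 ≠ 0 ∧ (K₁₂₃ 2) 1 ≠ 0 := by decide

/-- SCREEN vs Disproof §9 and `EnsembleCeiling/Negative/BeltramiFat`, `CellularFat`: `f₁₂₃` lives on THREE Stokes
shells (`|k|² = 1, 4, 9`), so it is not a Stokes eigenfunction, not single-shell, not Beltrami/ABC, not cellular. -/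
theorem screen_threeShells :
    Torus.freqNormSq (K₁₂₃ 0) = 1 ∧ Torus.freqNormSq (K₁₂₃ 1) = 4 ∧ Torus.freqNormSq (K₁₂₃ 2) = 9 := by
  refine ⟨?_, ?_, ?_⟩ <;> simp [Torus.freqNormSq, Fin.sum_univ_three] <;> norm_num

/-- SCREEN vs `EnsembleCeiling/Negative/OrthogonalClassFat` + `SingleModeFat`: `f₁₂₃` is NOT in the orthogonal
class — `k₂ · z₁ = -2i ≠ 0`. -/
theorem screen_not_orthogonalClass : ((fun j => ((K₁₂₃ 1) j : ℂ)) ⬝ᵥ (WithLp.ofLp (Z₁₂₃ 0))) ≠ 0 := by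
  simp [dotProduct, Fin.sum_univ_three, Matrix.cons_val_zero, Matrix.cons_val_one, Matrix.cons_val_two,
    Matrix.head_cons, Matrix.tail_cons, Complex.ext_iff]

/-! ## Landed machinery of the dead line (force-agnostic; PROVED in tree, restated by name — no sorry) -/

/-- **L2 = landed S2 `stub_residualTransfer`** (p85255): `RigidAt f E c δ₀ ⟹` every smooth admissible steady
state of `NS_ν(f)` with energy `≤ E` has `min c (δ₀²/ν) ≤ ν·gradNormSq u` (torus IBP + Cauchy–Schwarz). -/
theorem landed_residualTransfer :
    ∀ (ν E c δ₀ : ℝ) (f : UnitAddTorus (Fin 3) → EuclideanSpace ℝ (Fin 3)),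
      0 < ν → 0 < δ₀ → Torus.IsSmooth f →
      (∀ u : UnitAddTorus (Fin 3) → EuclideanSpace ℝ (Fin 3),
        Torus.IsSmooth u → Torus.IsDivFree u → Torus.HasZeroMean u → ∫ x, ‖u x‖ ^ 2 ≤ E →
        ∀ R : ℝ, 0 ≤ R →
          (∀ w : UnitAddTorus (Fin 3) → EuclideanSpace ℝ (Fin 3),
            Torus.IsSmooth w → Torus.IsDivFree w → Torus.HasZeroMean w →
            |∫ x, inner ℝ (Torus.convect u u x - f x) (w x)| ≤ R * Real.sqrt (Torus.gradNormSq w)) →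
          R ≤ δ₀ → c ≤ R * Real.sqrt (Torus.gradNormSq u)) →
      ∀ u : UnitAddTorus (Fin 3) → EuclideanSpace ℝ (Fin 3),
        Torus.IsSmooth u → Torus.IsDivFree u → Torus.HasZeroMean u →
        (∀ w : UnitAddTorus (Fin 3) → EuclideanSpace ℝ (Fin 3),
          Torus.IsSmooth w → Torus.IsDivFree w → Torus.HasZeroMean w →
          ∫ x, inner ℝ (ν • Torus.laplacian u x - Torus.convect u u x + f x) (w x) = 0) →
        ∫ x, ‖u x‖ ^ 2 ≤ E →
        min c (δ₀ ^ 2 / ν) ≤ ν * Torus.gradNormSq u :=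
  _root_.Summit.AnomalousDissipation.AnomalousDissipation.Theorems.SteadyStatesLoudBounded.ResidualTransfer.stub_residualTransfer

/-- **L3 = landed S3 `stub_compactnessSplit`** (p85561): no quiet `V`-Euler point in the closed `E`-ball and no
Onsager dodger at level `E` ⟹ `RigidAt f E c δ₀` for some `c, δ₀ > 0` (Rellich in `H` + continuity of the
inertial pairing). -/
theorem landed_compactnessSplit :
    ∀ (f : UnitAddTorus (Fin 3) → EuclideanSpace ℝ (Fin 3)) (E : ℝ), Torus.IsSmooth f →
      (∀ u : Torus.energySpace (Fin 3),
        (u : Lp (EuclideanSpace ℝ (Fin 3)) 2 (volume : Measure (UnitAddTorus (Fin 3)))) ∈ Torus.energySpaceV (Fin 3) →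
        Torus.IsSteadyWeakSolution 0 f u → E < ‖u‖ ^ 2) →
      (∀ (u : ℕ → UnitAddTorus (Fin 3) → EuclideanSpace ℝ (Fin 3)) (R : ℕ → ℝ),
        (∀ n : ℕ, Torus.IsSmooth (u n) ∧ Torus.IsDivFree (u n) ∧ Torus.HasZeroMean (u n) ∧
          ∫ x, ‖u n x‖ ^ 2 ≤ E ∧ 0 ≤ R n ∧
          ∀ w : UnitAddTorus (Fin 3) → EuclideanSpace ℝ (Fin 3),
            Torus.IsSmooth w → Torus.IsDivFree w → Torus.HasZeroMean w →
            |∫ x, inner ℝ (Torus.convect (u n) (u n) x - f x) (w x)| ≤ R n * Real.sqrt (Torus.gradNormSq w)) →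
        Tendsto R atTop (𝓝 0) →
        Tendsto (fun n => R n * Real.sqrt (Torus.gradNormSq (u n))) atTop (𝓝 0) →
        ∃ B : ℝ, ∀ N : ℕ, ∃ n : ℕ, N ≤ n ∧ Torus.gradNormSq (u n) ≤ B) →
      ∃ c δ₀ : ℝ, 0 < c ∧ 0 < δ₀ ∧
        ∀ u : UnitAddTorus (Fin 3) → EuclideanSpace ℝ (Fin 3),
          Torus.IsSmooth u → Torus.IsDivFree u → Torus.HasZeroMean u → ∫ x, ‖u x‖ ^ 2 ≤ E →
          ∀ R : ℝ, 0 ≤ R →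
            (∀ w : UnitAddTorus (Fin 3) → EuclideanSpace ℝ (Fin 3),
              Torus.IsSmooth w → Torus.IsDivFree w → Torus.HasZeroMean w →
              |∫ x, inner ℝ (Torus.convect u u x - f x) (w x)| ≤ R * Real.sqrt (Torus.gradNormSq w)) →
            R ≤ δ₀ → c ≤ R * Real.sqrt (Torus.gradNormSq u) :=
  _root_.Summit.AnomalousDissipation.AnomalousDissipation.Theorems.SteadyStatesLoudBounded.CompactnessSplit.stub_compactnessSplit

/-- **L4a = landed S4a `stub_truncationResidual`** (p85500): Fourier truncations of a finite-enstrophy standing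
flow `U ∈ V` of `f` have Euler residual bounds `r_N → 0` (`H¹ ⊂ L⁴` on `T³`). -/
theorem landed_truncationResidual :
    ∀ (f : UnitAddTorus (Fin 3) → EuclideanSpace ℝ (Fin 3)) (U : Torus.energySpace (Fin 3)), Torus.IsSmooth f →
      (U : Lp (EuclideanSpace ℝ (Fin 3)) 2 (volume : Measure (UnitAddTorus (Fin 3)))) ∈ Torus.energySpaceV (Fin 3) →
      Torus.IsSteadyWeakSolution 0 f U →
      ∃ r : ℕ → ℝ, (∀ N : ℕ, 0 ≤ r N) ∧ Tendsto r atTop (𝓝 0) ∧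
        ∀ (N : ℕ) (w : UnitAddTorus (Fin 3) → EuclideanSpace ℝ (Fin 3)),
          Torus.IsSmooth w → Torus.IsDivFree w → Torus.HasZeroMean w →
          |∫ x, inner ℝ (Torus.convect
              (Torus.fourierTruncate N
                ((U : Lp (EuclideanSpace ℝ (Fin 3)) 2 (volume : Measure (UnitAddTorus (Fin 3)))) :
                  UnitAddTorus (Fin 3) → EuclideanSpace ℝ (Fin 3)))
              (Torus.fourierTruncate N
                ((U : Lp (EuclideanSpace ℝ (Fin 3)) 2 (volume : Measure (UnitAddTorus (Fin 3)))) :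
                  UnitAddTorus (Fin 3) → EuclideanSpace ℝ (Fin 3))) x - f x) (w x)| ≤
            r N * Real.sqrt (Torus.gradNormSq w) :=
  _root_.Summit.AnomalousDissipation.AnomalousDissipation.Theorems.SteadyStatesLoudBounded.TruncationResidual.stub_truncationResidual

/-- **L4b = landed S4b `stub_dodgerAssembly`** (p89006): truncation + a vanishing high-frequency shear wiggle turn a
standing flow `U ∈ V` with `‖U‖² < E` into a bad sequence at level `E` with DIVERGENT enstrophy. -/
theorem landed_dodgerAssembly :
    ∀ (f : UnitAddTorus (Fin 3) → EuclideanSpace ℝ (Fin 3)) (E : ℝ) (U : Torus.energySpace (Fin 3)), Torus.IsSmooth f →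
      (U : Lp (EuclideanSpace ℝ (Fin 3)) 2 (volume : Measure (UnitAddTorus (Fin 3)))) ∈ Torus.energySpaceV (Fin 3) →
      ‖U‖ ^ 2 < E →
      (∃ r : ℕ → ℝ, (∀ N : ℕ, 0 ≤ r N) ∧ Tendsto r atTop (𝓝 0) ∧
        ∀ (N : ℕ) (w : UnitAddTorus (Fin 3) → EuclideanSpace ℝ (Fin 3)),
          Torus.IsSmooth w → Torus.IsDivFree w → Torus.HasZeroMean w →
          |∫ x, inner ℝ (Torus.convect
              (Torus.fourierTruncate N
                ((U : Lp (EuclideanSpace ℝ (Fin 3)) 2 (volume : Measure (UnitAddTorus (Fin 3)))) :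
                  UnitAddTorus (Fin 3) → EuclideanSpace ℝ (Fin 3)))
              (Torus.fourierTruncate N
                ((U : Lp (EuclideanSpace ℝ (Fin 3)) 2 (volume : Measure (UnitAddTorus (Fin 3)))) :
                  UnitAddTorus (Fin 3) → EuclideanSpace ℝ (Fin 3))) x - f x) (w x)| ≤
            r N * Real.sqrt (Torus.gradNormSq w)) →
      ∃ (u : ℕ → UnitAddTorus (Fin 3) → EuclideanSpace ℝ (Fin 3)) (R : ℕ → ℝ),
        (∀ n : ℕ, Torus.IsSmooth (u n) ∧ Torus.IsDivFree (u n) ∧ Torus.HasZeroMean (u n) ∧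
          ∫ x, ‖u n x‖ ^ 2 ≤ E ∧ 0 ≤ R n ∧
          ∀ w : UnitAddTorus (Fin 3) → EuclideanSpace ℝ (Fin 3),
            Torus.IsSmooth w → Torus.IsDivFree w → Torus.HasZeroMean w →
            |∫ x, inner ℝ (Torus.convect (u n) (u n) x - f x) (w x)| ≤ R n * Real.sqrt (Torus.gradNormSq w)) ∧
        Tendsto R atTop (𝓝 0) ∧
        Tendsto (fun n => R n * Real.sqrt (Torus.gradNormSq (u n))) atTop (𝓝 0) ∧
        ∀ B : ℝ, ∃ N : ℕ, ∀ n : ℕ, N ≤ n → B < Torus.gradNormSq (u n) :=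
  _root_.Summit.AnomalousDissipation.AnomalousDissipation.Theorems.SteadyStatesLoudBounded.DodgerAssembly.stub_dodgerAssembly

/-! ## The two registered stubs (both open; both pinned on `f₁₂₃`) -/

/-- **S1′ `stub_f123NoOnsagerDodgerLevel3`** — NO ONSAGER DODGERS FOR THE DETUNED CYCLIC FORCE BELOW ENERGY 3 (OPEN; HARDEST;
the ONE floor bet, now at the single energy level the composition consumes). Smooth div-free mean-zero `u_n` with `∫|u_n|² ≤ 3`
that balance `f₁₂₃` by inertia ever better (dual residual bounds `R_n → 0`) with vanishing virtual dissipation `R_n‖∇u_n‖₂ → 0`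
cannot escape to infinite roughness. WHY LEVEL 3 AND NOT ∀E (reshape by lead c1, 2026-08-16): the composition needs the dodger
exclusion only at the levels `E` and `E+1` where `E` is the steady ceiling, and the ceiling stub is now EXPLICIT (`E = 2`, twice the
largest energy seen on the resolved Stokes-connected branch, `E ≤ 1.10`); by monotonicity in the level (`noOnsagerDodger_mono`) the
level `3` suffices. WHAT THIS BUYS: the ∀E version is threatened GENERICALLY by vortex-sheet dodgers built from exact LARGE-DRIFT
steady Euler solutions `V = d + O(|d|⁻¹)` with invariant tori (lead a1, `Lines/lamb-floor-f123-shared-ceiling-S1-dodgers.md` §3b,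
energy `≈ |d|²`, conjectured to exist for all large semi-rational Diophantine `d` for essentially every force); at level 3 a sheet
dodger needs an exact drift solution of TOTAL energy `< 3`, i.e. `|d| < √3`, outside the perturbative regime — the remaining enemies
are O(1)-energy exact conservative standing flows of `f₁₂₃` (mean-zero quiet points, small-drift sheet states, `C^{σ>1/3}` flows), none
known, none found by Newton searches (strategist T3 degrees ≤ 3; the lead's K-ladders at `|d| ≤ 2`). WHY IT DECIDES THE FLOOR,
SHARPNESS, LEANS ON: as before (at a steady state `R = ν‖∇u‖`, `R‖∇u‖ = ε`; killed exactly by conservative standing flows of energy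
< 3; tools landed: `stub_badSeqZeroWork` — bad sequences do zero work asymptotically —, `stub_badSeqStrongLimit` — strong L² limits of
bad sequences are QUIET STANDING FLOWS (zero work, weak steady Euler) — and the small-energy regime `stub_f123NoOnsagerDodgerSmallEnergy`).
CYCLE-1 NUMERICS (lead c1, note v4 §4b–4c): the archived ∀E version is numerically FALSE — f₁₂₃ has exact analytic drift solutions
V = d + W for the rank-1-resonant direction d ∥ (2√2,2,1) at |d| = 4, 3, 2.5, 2 (K-ladders to K = 20, defect → 1e-13) whose flows keep the
whole resonant torus foliation Θ = 3x₂ − 6x₃ ≈ const (Θ-excursion ≤ 0.053 on all orbits), so Theorem A of the S1-dodgers note gives dodgers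
at every level E > |d|² + E_W ≥ 4.05; non-resonant directions give area-filling (ergodic) flows, no dodger. THIS stub (level 3) holds iff no
torus-carrying exact solution reaches total energy < 3: the (2√2,2,1) branch converges at |d| = 2 (E = 4.04) and fails at 1.5 (E = 2.33) —
its end is being located (kit j021288/j021874); if it reaches below 3 the level comes down to the ceiling⁺, if below the true ceiling
(≥ 1.13) the Lamb-rigidity floor is dead at f₁₂₃ in every variant. Size: open (XL). -/
theorem stub_f123NoOnsagerDodgerLevel3 :
    ∀ (u : ℕ → UnitAddTorus (Fin 3) → EuclideanSpace ℝ (Fin 3)) (R : ℕ → ℝ),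
      (∀ n : ℕ, Torus.IsSmooth (u n) ∧ Torus.IsDivFree (u n) ∧ Torus.HasZeroMean (u n) ∧
        ∫ x, ‖u n x‖ ^ 2 ≤ 3 ∧ 0 ≤ R n ∧
        ∀ w : UnitAddTorus (Fin 3) → EuclideanSpace ℝ (Fin 3),
          Torus.IsSmooth w → Torus.IsDivFree w → Torus.HasZeroMean w →
          |∫ x, inner ℝ (Torus.convect (u n) (u n) x - (f₁₂₃) x) (w x)| ≤ R n * Real.sqrt (Torus.gradNormSq w)) →
      Tendsto R atTop (𝓝 0) →
      Tendsto (fun n => R n * Real.sqrt (Torus.gradNormSq (u n))) atTop (𝓝 0) →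
      ∃ B : ℝ, ∀ N : ℕ, ∃ n : ℕ, N ≤ n ∧ Torus.gradNormSq (u n) ≤ B := by
  sorry

/-- **S2′ `stub_f123EnsembleCeiling2`** — THE SHARED CEILING, EXPLICIT (OPEN; HELD — not this line's mechanism). Below some
`ν₀ > 0` every stationary statistical solution of `NS_ν(f₁₂₃)` with integrable energy has mean energy `≤ 2`. The ∃E version is the
ensemble-ceiling half of the route's target `X` at `f₁₂₃` and is reduced to the sibling's fed HOT + WARM exclusions by the landed
`stub_f123EnsembleCeiling_of_fedExclusions` (p122431); the explicit constant `2` is twice the largest energy on the resolved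
Stokes-connected steady branch (`∫|u|² ≤ 1.10`, K ≤ 8 Galerkin, lead a1 4a; the lead's K ≤ 24 run refines it) and is what pins the
floor stub to level 3. WHY IT MIGHT FAIL: a fat/warm steady or recurrent fed state of `NS_ν(f₁₂₃)` (kills every E), or an O(1) state
with `2 < ∫|u|² ≲` few (kills only the constant: then raise it and the floor level together, as long as the floor level stays below
the energy of the cheapest exact non-ergodic drift solution). CYCLE-1 NUMERICS: primary branch loud and bounded to ν = 0.0021
(E ≤ 1.13, kit j019660); ABC/ray fat seeds on the full lattice at K = 8 (kit j020770) fall on the primary branch at ν = 0.02, 0.01, but at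
ν = 0.005 converge to two OTHER steady states, E = 1.38 (abc110+) and E = 9.56 (ray100+, cos 0.76 to the helical e₃-ray, Eν² ≈ 1.5 s²) — a
FAT candidate at marginal resolution whose K = 12 re-convergence and ν-continuation (kit j021868) decide this stub (and the crux at f₁₂₃).
Size: open (L+). -/
theorem stub_f123EnsembleCeiling2 :
    ∃ ν₀ : ℝ, 0 < ν₀ ∧ ∀ ν : ℝ, 0 < ν → ν < ν₀ →
      ∀ μ : Measure H3, Torus.IsStationaryStatisticalSolution ν f₁₂₃ μ →
        Integrable (fun v : H3 => ‖v‖ ^ 2) μ → Torus.ensembleEnergy μ ≤ 2 := by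
  sorry

/-! ## Vocabulary (definitional abbreviations; identical to the dead line's, so its sanity lemmas transfer) -/

/-- The crux's steady weak form of `NS_ν(f)` at a smooth `u` (verbatim the hypothesis block of the crux). -/
def IsCruxSteady (ν : ℝ) (f u : Vec3) : Prop :=
  ∀ w : Vec3, Torus.IsSmooth w → Torus.IsDivFree w → Torus.HasZeroMean w →
    ∫ x, inner ℝ (ν • Torus.laplacian u x - Torus.convect u u x + f x) (w x) = 0

/-- `R` bounds the Euler/Lamb residual functional `w ↦ ∫⟪(u·∇)u − f, w⟫` in the dual norm over the test class. -/
def IsResidualBound (f u : Vec3) (R : ℝ) : Prop :=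
  ∀ w : Vec3, Torus.IsSmooth w → Torus.IsDivFree w → Torus.HasZeroMean w →
    |∫ x, inner ℝ (Torus.convect u u x - f x) (w x)| ≤ R * Real.sqrt (Torus.gradNormSq w)

/-- **Lamb rigidity with a residual cap**: admissible near-solutions (`R ≤ δ₀`) of `P(u·∇)u = Pf` inside the energy
ball `∫|u|² ≤ E` are rough at rate `1/R`: `c ≤ R · ‖∇u‖₂`. -/
def RigidAt (f : Vec3) (E c δ₀ : ℝ) : Prop :=
  ∀ u : Vec3, Torus.IsSmooth u → Torus.IsDivFree u → Torus.HasZeroMean u → ∫ x, ‖u x‖ ^ 2 ≤ E →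
    ∀ R : ℝ, 0 ≤ R → IsResidualBound f u R → R ≤ δ₀ → c ≤ R * Real.sqrt (Torus.gradNormSq u)

/-- Enemy (Q) excluded at level `E`: no finite-enstrophy weak steady Euler state of `f` in the closed `E`-ball. -/
def NoQuietEulerPointV (f : Vec3) (E : ℝ) : Prop :=
  ∀ u : Torus.energySpace (Fin 3),
    (u : Lp (EuclideanSpace ℝ (Fin 3)) 2 (volume : Measure (UnitAddTorus (Fin 3)))) ∈ Torus.energySpaceV (Fin 3) →
    Torus.IsSteadyWeakSolution 0 f u → E < ‖u‖ ^ 2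

/-- A bad sequence at level `E`: admissible, energy `≤ E`, residual bounds `R_n → 0`, virtual dissipation → 0. -/
def IsBadSeq (f : Vec3) (E : ℝ) (u : ℕ → Vec3) (R : ℕ → ℝ) : Prop :=
  (∀ n : ℕ, Torus.IsSmooth (u n) ∧ Torus.IsDivFree (u n) ∧ Torus.HasZeroMean (u n) ∧
      ∫ x, ‖u n x‖ ^ 2 ≤ E ∧ 0 ≤ R n ∧ IsResidualBound f (u n) (R n)) ∧
    Tendsto R atTop (𝓝 0) ∧ Tendsto (fun n => R n * Real.sqrt (Torus.gradNormSq (u n))) atTop (𝓝 0)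

/-- Enemy (D) excluded at level `E`: bad sequences have non-divergent enstrophy. -/
def NoOnsagerDodger (f : Vec3) (E : ℝ) : Prop :=
  ∀ (u : ℕ → Vec3) (R : ℕ → ℝ), IsBadSeq f E u R → ∃ B : ℝ, ∀ N : ℕ, ∃ n : ℕ, N ≤ n ∧ Torus.gradNormSq (u n) ≤ B

/-- The steady energy ceiling of `f` below `ν₁` at level `E` (the CEILING conjunct of the crux at `f`). -/
def SteadyCeilingAt (f : Vec3) (E ν₁ : ℝ) : Prop :=
  ∀ ν : ℝ, 0 < ν → ν < ν₁ → ∀ u : Vec3, Torus.IsSmooth u → Torus.IsDivFree u → Torus.HasZeroMean u →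
    IsCruxSteady ν f u → ∫ x, ‖u x‖ ^ 2 ≤ E

/-! ## Folded forms and the ceiling bridge (all sorry-free) -/

theorem residualTransfer {ν E c δ₀ : ℝ} {f : Vec3} (hν : 0 < ν) (hδ₀ : 0 < δ₀) (hf : Torus.IsSmooth f)
    (hR : RigidAt f E c δ₀) {u : Vec3} (hus : Torus.IsSmooth u) (hud : Torus.IsDivFree u)
    (huz : Torus.HasZeroMean u) (hst : IsCruxSteady ν f u) (hE : ∫ x, ‖u x‖ ^ 2 ≤ E) :
    min c (δ₀ ^ 2 / ν) ≤ ν * Torus.gradNormSq u :=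
  landed_residualTransfer ν E c δ₀ f hν hδ₀ hf hR u hus hud huz hst hE

theorem rigidAt_of_noEnemies {f : Vec3} {E : ℝ} (hf : Torus.IsSmooth f) (hQ : NoQuietEulerPointV f E)
    (hD : NoOnsagerDodger f E) : ∃ c δ₀ : ℝ, 0 < c ∧ 0 < δ₀ ∧ RigidAt f E c δ₀ :=
  landed_compactnessSplit f E hf hQ (fun u R hseq hR hRD => hD u R ⟨hseq, hR, hRD⟩)

/-- Quiet `V`-points spawn dodgers one level up (L4a + L4b, pure logic as in the dead line's `dodgerOfQuietPoint`). -/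
theorem le_energy_of_quietPoint {f : Vec3} {E : ℝ} (hf : Torus.IsSmooth f) (hD : NoOnsagerDodger f E)
    (u : Torus.energySpace (Fin 3))
    (hV : (u : Lp (EuclideanSpace ℝ (Fin 3)) 2 (volume : Measure (UnitAddTorus (Fin 3)))) ∈ Torus.energySpaceV (Fin 3))
    (hsol : Torus.IsSteadyWeakSolution 0 f u) : E ≤ ‖u‖ ^ 2 := by
  by_contra hlt
  push Not at hlt
  obtain ⟨v, R, hbad, hR, hRG, hdiv⟩ :=
    landed_dodgerAssembly f E u hf hV hlt (landed_truncationResidual f u hf hV hsol)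
  obtain ⟨B, hB⟩ := hD v R ⟨hbad, hR, hRG⟩
  obtain ⟨N, hN⟩ := hdiv B
  obtain ⟨n, hn, hle⟩ := hB N
  exact absurd hle (not_le.mpr (hN n hn))

/-- Monotonicity of the dodger exclusion in the energy level: a bad sequence at level `E ≤ E'` is bad at level `E'`. -/
theorem noOnsagerDodger_mono {f : Vec3} {E E' : ℝ} (hEE' : E ≤ E') (h : NoOnsagerDodger f E') : NoOnsagerDodger f E :=
  fun u R ⟨hseq, hR, hRD⟩ =>
    h u R ⟨fun n => ⟨(hseq n).1, (hseq n).2.1, (hseq n).2.2.1, (hseq n).2.2.2.1.trans hEE', (hseq n).2.2.2.2⟩, hR, hRD⟩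

/-- S1′ folded: no dodger of `f₁₂₃` at level 3, hence at every level `E ≤ 3`. -/
theorem f123_noOnsagerDodger {E : ℝ} (hE : E ≤ 3) : NoOnsagerDodger f₁₂₃ E :=
  noOnsagerDodger_mono hE fun u R h => stub_f123NoOnsagerDodgerLevel3 u R h.1 h.2.1 h.2.2

/-- Enemy (Q) excluded for `f₁₂₃` at every level `E ≤ 2`, from L4 + S1′ (applied one level up, `E + 1 ≤ 3`). -/
theorem f123_noQuietEulerPointV (hf : Torus.IsSmooth f₁₂₃) {E : ℝ} (hE : E ≤ 2) : NoQuietEulerPointV f₁₂₃ E :=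
  fun u hV hsol => by
    have h := le_energy_of_quietPoint (E := E + 1) hf (f123_noOnsagerDodger (by linarith)) u hV hsol
    linarith

/-- **COROLLARY: `f₁₂₃` has no standing flow of finite enstrophy and energy `< 3`.** -/
theorem f123_noQuietEulerPoint (hf : Torus.IsSmooth f₁₂₃) (u : Torus.energySpace (Fin 3))
    (hV : (u : Lp (EuclideanSpace ℝ (Fin 3)) 2 (volume : Measure (UnitAddTorus (Fin 3)))) ∈ Torus.energySpaceV (Fin 3))
    (hu3 : ‖u‖ ^ 2 < 3) :
    ¬ Torus.IsSteadyWeakSolution 0 f₁₂₃ u := fun hsol => by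
  have h := le_energy_of_quietPoint (E := 3) hf (f123_noOnsagerDodger le_rfl) u hV hsol
  linarith

/-- **Bridge, classical ⇒ `H`-weak (sorry-free; local copy of `KolmogorovFloorEnsembleCeiling.Negative.
exists_steadyState_of_classical`, kept in-file so that this skeleton's import cone stays inside modules the farm
serves).** A smooth admissible classical steady state `u` of `NS_ν(f)` (the crux's weak form) is carried by the
state `U := [u] ∈ V ⊆ H`, which is a steady weak solution in the tree's sense `Torus.IsSteadyWeakSolution`
(generator pairing with all derivatives on the test field: Green's second identity and the antisymmetry of the
trilinear form move them back onto `u`). -/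
theorem exists_steadyState_of_classical' {ν : ℝ} {f u : Vec3}
    (hf : Torus.IsSmooth f) (hu : Torus.IsSmooth u) (hdiv : Torus.IsDivFree u) (hmean : Torus.HasZeroMean u)
    (hsteady : IsCruxSteady ν f u) :
    ∃ U : Torus.energySpace (Fin 3),
      ((U : L2) : Vec3) =ᵐ[volume] u ∧ (U : L2) ∈ Torus.energySpaceV (Fin 3) ∧ Torus.IsSteadyWeakSolution ν f U := by
  have hsol : (hu.memLp 2).toLp u ∈ Torus.smoothSolenoidal (Fin 3) := ⟨u, hu, hdiv, hmean, MemLp.coeFn_toLp _⟩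
  refine ⟨⟨(hu.memLp 2).toLp u, Torus.smoothSolenoidal_subset_energySpace hsol⟩, (hu.memLp 2).coeFn_toLp,
    Torus.smoothSolenoidal_subset_energySpaceV_holds hsol, fun w hw hdw hzw => ?_⟩
  have hU : ((((⟨(hu.memLp 2).toLp u, Torus.smoothSolenoidal_subset_energySpace hsol⟩ :
      Torus.energySpace (Fin 3)) : L2) : Vec3)) =ᵐ[volume] u := (hu.memLp 2).coeFn_toLp
  -- the generator pairing written on the representative `u`
  have h1 : (∫ x, inner ℝ ((((⟨(hu.memLp 2).toLp u, Torus.smoothSolenoidal_subset_energySpace hsol⟩ :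
        Torus.energySpace (Fin 3)) : L2) : Vec3) x) (Torus.laplacian w x)) = ∫ x, inner ℝ (u x) (Torus.laplacian w x) := by
    refine integral_congr_ae ?_
    filter_upwards [hU] with x hx
    rw [hx]
  have h2 : (∫ x, inner ℝ (Torus.fderiv w x ((((⟨(hu.memLp 2).toLp u, Torus.smoothSolenoidal_subset_energySpace hsol⟩ :
        Torus.energySpace (Fin 3)) : L2) : Vec3) x))
        ((((⟨(hu.memLp 2).toLp u, Torus.smoothSolenoidal_subset_energySpace hsol⟩ :
        Torus.energySpace (Fin 3)) : L2) : Vec3) x)) = ∫ x, inner ℝ (Torus.fderiv w x (u x)) (u x) := by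
    refine integral_congr_ae ?_
    filter_upwards [hU] with x hx
    rw [hx]
  unfold Torus.nsGeneratorPairing Torus.inertialPairing
  rw [h1, h2]
  -- `(f, w) + ν (u, Δw) + ∫⟪Dw·u, u⟫ = ∫⟪νΔu − (u·∇)u + f, w⟫ = 0`
  have hlap : ∫ x, inner ℝ (u x) (Torus.laplacian w x) = ∫ x, inner ℝ (Torus.laplacian u x) (w x) :=
    (Torus.integral_inner_laplacian_comm hu hw).symm
  have hconv : ∫ x, inner ℝ (Torus.fderiv w x (u x)) (u x) = -∫ x, inner ℝ (Torus.convect u u x) (w x) := by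
    change ∫ x, inner ℝ (Torus.convect u w x) (u x) = _
    rw [Torus.integral_inner_convect_eq_neg hu hdiv hw hu]
    congr 1
    exact integral_congr_ae (ae_of_all _ fun x => real_inner_comm _ _)
  have i1 : Integrable (fun x => inner ℝ (ν • Torus.laplacian u x) (w x)) volume := by
    have := ((hu.laplacian.inner hw).integrable).const_mul ν
    refine this.congr (ae_of_all _ fun x => ?_)
    simp [inner_smul_left]
  have i2 : Integrable (fun x => inner ℝ (Torus.convect u u x) (w x)) volume := ((hu.convect hu).inner hw).integrable
  have i3 : Integrable (fun x => inner ℝ (f x) (w x)) volume := (hf.inner hw).integrable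
  have key : ∫ x, inner ℝ (ν • Torus.laplacian u x - Torus.convect u u x + f x) (w x) =
      (∫ x, inner ℝ (f x) (w x)) + ν * (∫ x, inner ℝ (u x) (Torus.laplacian w x)) +
        ∫ x, inner ℝ (Torus.fderiv w x (u x)) (u x) := by
    simp_rw [inner_add_left, inner_sub_left]
    rw [integral_add ?_ i3, integral_sub i1 i2, hlap, hconv]
    · have : ∫ x, inner ℝ (ν • Torus.laplacian u x) (w x) = ν * ∫ x, inner ℝ (Torus.laplacian u x) (w x) := by
        rw [← integral_const_mul]
        refine integral_congr_ae (ae_of_all _ fun x => ?_)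
        simp [inner_smul_left]
      rw [this]
      ring
    · exact i1.sub i2
  rw [← key]
  exact hsteady w hw hdw hzw

/-- **THE CEILING BRIDGE (sorry-free): the shared ensemble ceiling S2 gives the steady ceiling at `f₁₂₃`.** A smooth
classical steady state `u` of `NS_ν(f₁₂₃)` is carried by a state `U ∈ V` solving the steady equations weakly
(`exists_steadyState_of_classical'`); the Dirac mass at `U` is a stationary statistical solution with integrable
energy, so the ensemble ceiling reads `‖U‖² ≤ E` (`DiracAtoms.norm_sq_le_of_ceiling`), and `‖U‖² = ∫|u|²`
(`norm_sq_of_ae`). -/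
theorem f123_steadyCeiling : ∃ ν₁ : ℝ, 0 < ν₁ ∧ SteadyCeilingAt f₁₂₃ 2 ν₁ := by
  obtain ⟨ν₁, hν₁, h⟩ := stub_f123EnsembleCeiling2
  have hfs : Torus.IsSmooth f₁₂₃ := f123_smooth_divFree_zeroMean.1
  refine ⟨ν₁, hν₁, fun ν hν hνlt u hus hud huz hst => ?_⟩
  obtain ⟨U, hU, hV, hUsteady⟩ := exists_steadyState_of_classical' hfs hus hud huz hst
  have hbdd : ‖U‖ ^ 2 ≤ 2 := norm_sq_le_of_ceiling hν (hfs.memLp 2) (h ν hν hνlt) hV hUsteady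
  rwa [norm_sq_of_ae hU] at hbdd

/-! ## Sanity (sorry-free): the floor stub is not vacuous in the wrong direction -/

/-- A smooth quiet Euler point of energy `≤ E` kills rigidity at level `E` for every `c > 0`, `δ₀ ≥ 0` — so enemy
(Q) genuinely has to be excluded (and is, for `f₁₂₃`, by `f123_noQuietEulerPoint` given S1). -/
theorem not_rigidAt_of_quietPoint {f v : Vec3} {E c δ₀ : ℝ} (hc : 0 < c) (hδ₀ : 0 ≤ δ₀)
    (hvs : Torus.IsSmooth v) (hvd : Torus.IsDivFree v) (hvz : Torus.HasZeroMean v)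
    (hvE : ∫ x, ‖v x‖ ^ 2 ≤ E)
    (hquiet : ∀ w : Vec3, Torus.IsSmooth w → Torus.IsDivFree w → Torus.HasZeroMean w →
      ∫ x, inner ℝ (Torus.convect v v x - f x) (w x) = 0) :
    ¬ RigidAt f E c δ₀ := by
  intro hR
  have h0 : IsResidualBound f v 0 := fun w hws hwd hwz => by
    rw [hquiet w hws hwd hwz, abs_zero, zero_mul]
  have := hR v hvs hvd hvz hvE 0 le_rfl h0 hδ₀
  rw [zero_mul] at this
  exact absurd this (not_le.mpr hc)

/-! ## The composition: the crux BY NAME from S1 + S2 (kernel-checked, no sorry outside the stubs) -/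

/-- **`SteadyStatesLoudBounded` from the two stubs.** Witness force `f₁₂₃` (admissible: PROVED); `E, ν₁` from the
derived steady ceiling; `(c, δ₀)` from the compactness split L3 fed with (Q) (= L4 + S1 at level `E+1`) and S1 at
`E`; `ν₀ := min ν₁ 1`, `ε₀ := min c (δ₀²)`; for `ν ∈ (0, ν₀)` a steady state has `∫|u|² ≤ E` and then
`ν·gradNormSq u ≥ min c (δ₀²/ν) ≥ min c (δ₀²)` (L2, using `ν < 1`). -/
theorem SteadyStatesLoudBounded_of : SteadyStatesLoudBounded := by
  obtain ⟨hfs, hfd, hfz⟩ := f123_smooth_divFree_zeroMean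
  obtain ⟨ν₁, hν₁, hceil⟩ := f123_steadyCeiling
  obtain ⟨c, δ₀, hc, hδ₀, hrig⟩ :=
    rigidAt_of_noEnemies (E := 2) hfs (f123_noQuietEulerPointV hfs le_rfl) (f123_noOnsagerDodger (by norm_num))
  refine ⟨f₁₂₃, hfs, hfd, hfz, min c (δ₀ ^ 2), 2, min ν₁ 1, lt_min hc (pow_pos hδ₀ 2),
    lt_min hν₁ one_pos, ?_⟩
  intro ν hν hνlt u hus hud huz hsteady
  have hν₁' : ν < ν₁ := lt_of_lt_of_le hνlt (min_le_left _ _)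
  have hν1 : ν < 1 := lt_of_lt_of_le hνlt (min_le_right _ _)
  have hE : ∫ x, ‖u x‖ ^ 2 ≤ 2 := hceil ν hν hν₁' u hus hud huz hsteady
  refine ⟨?_, hE⟩
  have hfloor : min c (δ₀ ^ 2 / ν) ≤ ν * Torus.gradNormSq u :=
    residualTransfer hν hδ₀ hfs hrig hus hud huz hsteady hE
  have hdiv : δ₀ ^ 2 ≤ δ₀ ^ 2 / ν := by
    rw [le_div_iff₀ hν]
    nlinarith [sq_nonneg δ₀]
  exact (min_le_min le_rfl hdiv).trans hfloor

end Summit.AnomalousDissipation.AnomalousDissipation.Cruxes.SteadyStatesLoudBounded.LambFloorF123SharedCeiling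

end
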